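import Literature.Analysis.FluidPDE.PassiveScalarExistenceApprox
import Literature.Analysis.FluidPDE.PassiveScalarWellPosednessProofs
import Literature.Analysis.FluidPDE.PassiveScalarClassicalEnergy
import Literature.Analysis.FunctionSpaces.SpaceTimeWeakCompactness
import HarnessLib

/-!
# Existence of weak solutions of the passive scalar equation, II: the weak limit
  (discharge of `Torus.exists_isWeakScalarTransportOn`)

Analysis/FluidPDE proof file for the named fact
`Literature.Analysis.FluidPDE.Torus.exists_isWeakScalarTransportOn` of `FluidPDE/PassiveScalar`:
for `κ > 0`, an `L²` datum `θ₀` and a bounded velocity field `u ∈ L^∞((0,T) × T^d)` which is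
weakly divergence free at a.e. time there is a weak solution `θ` of `∂ₜθ + u·∇θ = κΔθ` on
`T^d × [0,T)` with datum `θ₀` (`Torus.IsWeakScalarTransportOn T κ u θ₀ θ`) satisfying the energy
inequality `2κ ∫₀ᵀ ‖∇θ‖²_{L²} ≤ ‖θ₀‖²_{L²}` (DiPerna–Lions 1989, Prop. II.1: existence for the
transport part by regularisation of the coefficients and the datum, the a priori bound and a
weak-* limit; Evans 2010, §7.1.2, Thm. 2–3: the parabolic energy estimate).

## The argument (DiPerna–Lions 1989, proof of Prop. II.1, in the parabolic setting)

1. *Regularisation* (`PassiveScalarExistenceApprox`): smooth divergence-free drifts `vₙ → u` in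
   `L²((0,T) × T^d)` and smooth data `gₙ → θ₀` in `L²(T^d)` with `‖gₙ‖₂ ≤ ‖θ₀‖₂`.
2. *Regularised problems*: the classical solutions `θₙ` of `∂ₜθₙ + vₙ·∇θₙ = κΔθₙ`, `θₙ(0) = gₙ`
   on `[0,T] × T^d` (the tree's classical well-posedness
   `Torus.exists_unique_isClassicalScalarTransportForcedOn_holds`) are weak solutions
   (`IsClassicalScalarTransportOn.isWeakScalarTransportOn_holds`) and obey the energy identity
   (`IsClassicalScalarTransportOn.scalarL2Sq_add_scalarDissipation_holds`), whence the a priori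
   bound `‖θₙ(t)‖₂ ≤ ‖gₙ‖₂ ≤ ‖θ₀‖₂` — uniformly in `n` and independent of the drift.
3. *Weak-* limit*: a subsequence converges weak-* in `L^∞(0,T; L²(T^d))` to some `W` of the same
   class (`Torus.exists_strictMono_weakLimit_of_lintegral_sq_le`, Banach–Alaoglu).
4. *Identification* (`IsWeakScalarTransportOn.of_tendsto`, the only analytic step of this file):
   the weak formulation is linear in `θ`; `θₙ ⇀ W` weakly, `vₙ → u` and `gₙ → θ₀` strongly in `L²`,
   so `∫∫ θₙ (∂ₜψ + vₙ·∇ψ + κΔψ) + ∫ gₙ ψ(0) → ∫∫ W (∂ₜψ + u·∇ψ + κΔψ) + ∫ θ₀ ψ(0)` for every test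
   function `ψ` (weak × strong convergence of the transport term by Cauchy–Schwarz with the uniform
   `L²` bound); the remaining clauses of the solution class (`u ∈ L¹_t L²_x`, `uW ∈ L¹`) follow
   from the boundedness of `u`.
5. *Energy inequality*: every weak solution with bounded drift satisfies it
   (`IsWeakScalarTransportOn.energy_ineq_holds`, DEIJ 2022, (1.2)–(1.3)).

For `T ≤ 0` the statement is degenerate (`(0,T) = ∅` and test functions vanish at `t = 0`), and
`θ = 0` is a solution (`IsWeakScalarTransportOn.of_nonpos`).

## References

* R. J. DiPerna, P.-L. Lions, *Ordinary differential equations, transport theory and Sobolev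
  spaces*, Invent. Math. 98 (1989), 511–547, §II.1, Prop. II.1. [DiPernaLions1989]
* L. C. Evans, *Partial Differential Equations*, 2nd ed. (AMS 2010), §7.1.2, Thm. 2–4.
  [Evans2010]
* T. D. Drivas, T. M. Elgindi, G. Iyer, I.-J. Jeong, *Anomalous dissipation in passive scalar
  transport*, Arch. Ration. Mech. Anal. 243 (2022), (1.1)–(1.3). [DEIJ2022]
-/

noncomputable section

open MeasureTheory TopologicalSpace Set Function Filter Metric
open _root_.Topology
open scoped ENNReal NNReal InnerProductSpace

namespace Literature.Analysis.FluidPDE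

namespace Torus

variable {d : Type*} [Fintype d]

/-! ## The degenerate case `T ≤ 0` -/

omit [Fintype d] in
/-- For `T ≤ 0` the time interval `(0,T)` is empty and every admissible test function vanishes at
`t = 0`, so every field is a weak solution on `T^d × [0,T)` (all clauses are integrals over `∅`
or a.e. statements for the zero measure). [folklore] -/
theorem IsWeakScalarTransportOn.of_nonpos [Fintype d] {T κ : ℝ} (hT : T ≤ 0)
    {u : ℝ → UnitAddTorus d → EuclideanSpace ℝ d} {θ₀ : UnitAddTorus d → ℝ}
    (θ : ℝ → UnitAddTorus d → ℝ)
    (hu : AEStronglyMeasurable (FunctionSpaces.Torus.stLift u) (volume.restrict (Ioo 0 T ×ˢ univ))) :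
    IsWeakScalarTransportOn T κ u θ₀ θ := by
  have hI : Ioo (0 : ℝ) T = ∅ := Ioo_eq_empty (not_lt.2 hT)
  have hμ : (volume : Measure ℝ).restrict (Ioo 0 T) = 0 := by rw [hI, Measure.restrict_empty]
  refine ⟨?_, hu, ⟨0, ?_⟩, ?_, ?_, ?_, fun ψ hψ => ?_⟩
  · rw [hI, empty_prod, Measure.restrict_empty]
    exact aestronglyMeasurable_zero_measure _
  · rw [hμ, ae_zero]; exact eventually_bot
  · rw [hμ, lintegral_zero_measure]; exact ENNReal.zero_lt_top
  · rw [hμ, lintegral_zero_measure]; exact ENNReal.zero_lt_top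
  · rw [hμ, ae_zero]; exact eventually_bot
  · obtain ⟨T', hT', hψT'⟩ := hψ.2
    have h0 : ψ 0 = 0 := hψT' 0 (by linarith)
    rw [hμ, integral_zero_measure, h0]
    simp

/-! ## Identification of weak limits of weak solutions -/

section Limit

variable {T κ : ℝ} {C : ℝ≥0} {u : ℝ → UnitAddTorus d → EuclideanSpace ℝ d}
  {v : ℕ → ℝ → UnitAddTorus d → EuclideanSpace ℝ d} {θ₀ : UnitAddTorus d → ℝ}
  {g : ℕ → UnitAddTorus d → ℝ} {θ : ℕ → ℝ → UnitAddTorus d → ℝ} {W : ℝ → UnitAddTorus d → ℝ}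

/-- **Stability of weak solutions under weak-* convergence with strongly convergent data**
(the passage to the limit of DiPerna–Lions 1989, proof of Prop. II.1, p. 518: "we may pass to the
limit in (13) since the equation is linear"; Evans 2010, §7.1.2, Thm. 3, Step 2, for the
parabolic Galerkin limit). Let `θₙ` be weak solutions of `∂ₜθₙ + vₙ·∇θₙ = κΔθₙ` on `T^d × [0,T)`
with data `gₙ`, uniformly bounded in `L^∞(0,T; L²)` (`∫ |θₙ(t)|² ≤ C` for a.e. `t`), and let
`W` be a field of the same class to which `θₙ` converges weakly in `L²((0,T) × T^d)` (pairings
against every square-integrable `G` converge). If `u ∈ L^∞((0,T) × T^d)` is weakly divergence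
free at a.e. time, `vₙ → u` in `L²((0,T) × T^d)` and `gₙ → θ₀` in `L²(T^d)`, then `W` is a weak
solution of `∂ₜW + u·∇W = κΔW` with datum `θ₀`. [cite: DiPernaLions1989, Prop. II.1, proof] -/
theorem IsWeakScalarTransportOn.of_tendsto
    (hsol : ∀ n, IsWeakScalarTransportOn T κ (v n) (g n) (θ n))
    (hbd : ∀ n, ∀ᵐ t ∂(volume.restrict (Ioo 0 T)), ∫⁻ x, ‖θ n t x‖ₑ ^ 2 ≤ C)
    (hWm : AEStronglyMeasurable (FunctionSpaces.Torus.stLift W) (volume.restrict (Ioo 0 T ×ˢ univ)))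
    (hWb : ∀ᵐ t ∂(volume.restrict (Ioo 0 T)), ∫⁻ x, ‖W t x‖ₑ ^ 2 ≤ C)
    (hlim : ∀ G : ℝ → UnitAddTorus d → ℝ,
      AEStronglyMeasurable (FunctionSpaces.Torus.stLift G) (volume.restrict (Ioo 0 T ×ˢ univ)) →
      ∫⁻ t in Ioo 0 T, ∫⁻ x, ‖G t x‖ₑ ^ 2 < ⊤ →
      Tendsto (fun n => ∫ t in Ioo 0 T, ∫ x, θ n t x * G t x) atTop
        (𝓝 (∫ t in Ioo 0 T, ∫ x, W t x * G t x)))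
    (hu : MemLp (FunctionSpaces.Torus.stLift u) ⊤ (volume.restrict (Ioo 0 T ×ˢ univ)))
    (hdiv : ∀ᵐ t ∂(volume.restrict (Ioo 0 T)), FunctionSpaces.Torus.IsWeaklyDivFree (u t))
    (hv : Tendsto (fun n => eLpNorm (fun q : ℝ × UnitAddTorus d => v n q.1 q.2 - u q.1 q.2) 2
      (((volume : Measure ℝ).restrict (Ioo 0 T)).prod volume)) atTop (𝓝 0))
    (hθ₀ : MemLp θ₀ 2 volume) (hg : ∀ n, MemLp (g n) 2 volume)
    (hgθ₀ : Tendsto (fun n => eLpNorm (g n - θ₀) 2 volume) atTop (𝓝 0)) :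
    IsWeakScalarTransportOn T κ u θ₀ W := by
  set μ : Measure (ℝ × UnitAddTorus d) :=
    ((volume : Measure ℝ).restrict (Ioo 0 T)).prod (volume : Measure (UnitAddTorus d)) with hμ
  haveI : IsFiniteMeasure ((volume : Measure ℝ).restrict (Ioo 0 T)) :=
    isFiniteMeasure_restrict.2 measure_Ioo_lt_top.ne
  haveI : IsFiniteMeasure μ := by rw [hμ]; infer_instance
  -- the drift: a.e. bounds and measurability
  obtain ⟨Cu, hCu0, hCu⟩ := ae_norm_le_prod_of_memLp_top_stLift hu
  obtain ⟨Cu', -, hCu'⟩ := ae_ae_norm_le_of_memLp_top_stLift hu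
  have hum : AEStronglyMeasurable (uncurry u) μ :=
    FunctionSpaces.Torus.aestronglyMeasurable_uncurry_of_stLift_prod hu.1
  have hWm' : AEStronglyMeasurable (uncurry W) μ :=
    FunctionSpaces.Torus.aestronglyMeasurable_uncurry_of_stLift_prod hWm
  -- slice bounds: `∫⁻ ‖u t‖ₑ² ≤ Cu'²` for a.e. `t`
  have hu2 : ∀ᵐ t ∂(volume.restrict (Ioo 0 T)), ∫⁻ x, ‖u t x‖ₑ ^ 2 ≤ ENNReal.ofReal Cu' ^ 2 := by
    filter_upwards [hCu'] with t ht
    calc ∫⁻ x, ‖u t x‖ₑ ^ 2 ≤ ∫⁻ _ : UnitAddTorus d, ENNReal.ofReal Cu' ^ 2 := by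
          refine lintegral_mono_ae ?_
          filter_upwards [ht] with x hx
          gcongr
          rw [← ofReal_norm]
          exact ENNReal.ofReal_le_ofReal hx
      _ = ENNReal.ofReal Cu' ^ 2 := by rw [lintegral_const, measure_univ, mul_one]
  refine ⟨hWm, hu.1, ⟨C, hWb⟩, ?_, ?_, hdiv, fun ψ hψ => ?_⟩
  · -- `u ∈ L¹(0,T; L²)`
    calc ∫⁻ t in Ioo 0 T, (∫⁻ x, ‖u t x‖ₑ ^ 2) ^ (1 / 2 : ℝ)
        ≤ ∫⁻ _ in Ioo 0 T, (ENNReal.ofReal Cu' ^ 2) ^ (1 / 2 : ℝ) := by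
          refine lintegral_mono_ae ?_
          filter_upwards [hu2] with t ht
          exact ENNReal.rpow_le_rpow ht (by norm_num)
      _ < ⊤ := by
          rw [lintegral_const, Measure.restrict_apply_univ]
          exact ENNReal.mul_lt_top (ENNReal.rpow_lt_top_of_nonneg (by norm_num)
            (ENNReal.pow_ne_top ENNReal.ofReal_ne_top)) measure_Ioo_lt_top
  · -- `u W ∈ L¹((0,T) × T^d)`
    have hWs : ∀ᵐ t ∂(volume.restrict (Ioo 0 T)), AEStronglyMeasurable (W t) volume := hWm'.prodMk_left
    calc ∫⁻ t in Ioo 0 T, ∫⁻ x, ‖u t x‖ₑ * ‖W t x‖ₑ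
        ≤ ∫⁻ _ in Ioo 0 T, ENNReal.ofReal Cu' * (C : ℝ≥0∞) ^ (1 / 2 : ℝ) := by
          refine lintegral_mono_ae ?_
          filter_upwards [hCu', hWb, hWs] with t ht htW htm
          calc ∫⁻ x, ‖u t x‖ₑ * ‖W t x‖ₑ ≤ ∫⁻ x, ENNReal.ofReal Cu' * ‖W t x‖ₑ := by
                refine lintegral_mono_ae ?_
                filter_upwards [ht] with x hx
                gcongr
                rw [← ofReal_norm]
                exact ENNReal.ofReal_le_ofReal hx
            _ = ENNReal.ofReal Cu' * eLpNorm (W t) 1 volume := by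
                rw [lintegral_const_mul' _ _ ENNReal.ofReal_ne_top, eLpNorm_one_eq_lintegral_enorm]
            _ ≤ ENNReal.ofReal Cu' * eLpNorm (W t) 2 volume := by
                gcongr
                exact eLpNorm_le_eLpNorm_of_exponent_le one_le_two htm
            _ ≤ ENNReal.ofReal Cu' * (C : ℝ≥0∞) ^ (1 / 2 : ℝ) := by
                gcongr
                rw [FunctionSpaces.eLpNorm_two_eq_pow_two_rpow_half, FunctionSpaces.eLpNorm_two_pow_two_eq_lintegral]
                exact ENNReal.rpow_le_rpow htW (by norm_num)
      _ < ⊤ := by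
          rw [lintegral_const, Measure.restrict_apply_univ]
          exact ENNReal.mul_lt_top (ENNReal.mul_lt_top ENNReal.ofReal_lt_top
            (ENNReal.rpow_lt_top_of_nonneg (by norm_num) ENNReal.coe_ne_top)) measure_Ioo_lt_top
  · -- the weak formulation in the limit
    set G : ℝ → UnitAddTorus d → ℝ := fun t x =>
      FunctionSpaces.Torus.timeDeriv ψ t x + ⟪u t x, FunctionSpaces.Torus.gradient (ψ t) x⟫_ℝ +
        κ * FunctionSpaces.Torus.laplacian (ψ t) x with hG
    set H : ℕ → ℝ → UnitAddTorus d → ℝ := fun n t x =>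
      ⟪v n t x - u t x, FunctionSpaces.Torus.gradient (ψ t) x⟫_ℝ with hH
    change (∫ t in Ioo 0 T, ∫ x, W t x * G t x) + ∫ x, θ₀ x * ψ 0 x = 0
    -- bounds on the test function
    obtain ⟨C₁, hC₁⟩ := exists_bound_of_continuous_uncurry hψ.continuous_uncurry_timeDeriv 0 T
    obtain ⟨C₂, hC₂⟩ := exists_bound_of_continuous_uncurry hψ.continuous_uncurry_gradient 0 T
    obtain ⟨C₃, hC₃⟩ := exists_bound_of_continuous_uncurry hψ.continuous_uncurry_laplacian 0 T
    have hψc : Continuous (uncurry ψ) := FunctionSpaces.Torus.continuous_uncurry_of_continuous_stLift hψ.1.continuous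
    obtain ⟨C₀, hC₀⟩ := exists_bound_of_continuous_uncurry hψc 0 0
    have hψ0 : ∀ x, ‖ψ 0 x‖ ≤ C₀ := fun x => hC₀ 0 (left_mem_Icc.2 le_rfl) x
    have hψ0c : Continuous (ψ 0) := hψc.comp (Continuous.prodMk_right 0)
    have hae : ∀ᵐ p ∂μ, p.1 ∈ Ioo 0 T :=
      (Measure.quasiMeasurePreserving_fst (μ := (volume : Measure ℝ).restrict (Ioo 0 T))
        (ν := (volume : Measure (UnitAddTorus d)))).ae (ae_restrict_mem measurableSet_Ioo)
    -- `G` is bounded a.e. and measurable, hence square integrable, on `(0,T) × T^d`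
    set M : ℝ := C₁ + Cu * C₂ + |κ| * C₃ with hM
    have hGbd : ∀ᵐ p ∂μ, ‖G p.1 p.2‖ ≤ M := by
      filter_upwards [hae, hCu] with p hp hpu
      have hp' : p.1 ∈ Icc 0 T := Ioo_subset_Icc_self hp
      have h1 : ‖FunctionSpaces.Torus.timeDeriv ψ p.1 p.2‖ ≤ C₁ := hC₁ p.1 hp' p.2
      have h2 : ‖⟪u p.1 p.2, FunctionSpaces.Torus.gradient (ψ p.1) p.2⟫_ℝ‖ ≤ Cu * C₂ :=
        (norm_inner_le_norm _ _).trans (mul_le_mul hpu (hC₂ p.1 hp' p.2) (norm_nonneg _) hCu0)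
      have h3 : ‖κ * FunctionSpaces.Torus.laplacian (ψ p.1) p.2‖ ≤ |κ| * C₃ := by
        rw [norm_mul, Real.norm_eq_abs]
        exact mul_le_mul_of_nonneg_left (hC₃ p.1 hp' p.2) (abs_nonneg _)
      calc ‖G p.1 p.2‖ ≤ ‖FunctionSpaces.Torus.timeDeriv ψ p.1 p.2‖ +
            ‖⟪u p.1 p.2, FunctionSpaces.Torus.gradient (ψ p.1) p.2⟫_ℝ‖ + ‖κ * FunctionSpaces.Torus.laplacian (ψ p.1) p.2‖ :=
            norm_add₃_le
        _ ≤ M := add_le_add (add_le_add h1 h2) h3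
    have hGm : AEStronglyMeasurable (uncurry G) μ := by
      change AEStronglyMeasurable (fun p : ℝ × UnitAddTorus d =>
        FunctionSpaces.Torus.timeDeriv ψ p.1 p.2 + ⟪u p.1 p.2, FunctionSpaces.Torus.gradient (ψ p.1) p.2⟫_ℝ +
          κ * FunctionSpaces.Torus.laplacian (ψ p.1) p.2) μ
      refine ((?_ : AEStronglyMeasurable _ μ).add ?_).add ?_
      · exact hψ.continuous_uncurry_timeDeriv.aestronglyMeasurable
      · exact hum.inner hψ.continuous_uncurry_gradient.aestronglyMeasurable
      · exact (continuous_const.mul hψ.continuous_uncurry_laplacian).aestronglyMeasurable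
    have hG2 : ∫⁻ t in Ioo 0 T, ∫⁻ x, ‖G t x‖ₑ ^ 2 < ⊤ := by
      have h1 : ∫⁻ p, ‖uncurry G p‖ₑ ^ 2 ∂μ ≤ ∫⁻ _, ENNReal.ofReal M ^ 2 ∂μ := by
        refine lintegral_mono_ae ?_
        filter_upwards [hGbd] with p hp
        gcongr
        rw [← ofReal_norm]
        exact ENNReal.ofReal_le_ofReal hp
      rw [lintegral_prod _ (hGm.aemeasurable.enorm.pow_const 2)] at h1
      refine lt_of_le_of_lt h1 ?_
      rw [lintegral_const]
      exact ENNReal.mul_lt_top (ENNReal.pow_lt_top ENNReal.ofReal_lt_top) (measure_lt_top _ _)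
    have hGst : AEStronglyMeasurable (FunctionSpaces.Torus.stLift G) (volume.restrict (Ioo 0 T ×ˢ univ)) :=
      FunctionSpaces.Torus.aestronglyMeasurable_stLift_of_uncurry hGm
    -- (a) the weak convergence `∫∫ θₙ G → ∫∫ W G`
    have hA := hlim G hGst hG2
    -- (b) the splitting of the `n`-th weak identity
    have hθG : ∀ n, Integrable (fun p : ℝ × UnitAddTorus d => θ n p.1 p.2 * G p.1 p.2) μ := fun n =>
      (hsol n).integrable_uncurry.mul_bdd hGm hGbd
    have hθGn : ∀ n, Integrable (fun p : ℝ × UnitAddTorus d => θ n p.1 p.2 *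
        (FunctionSpaces.Torus.timeDeriv ψ p.1 p.2 + ⟪v n p.1 p.2, FunctionSpaces.Torus.gradient (ψ p.1) p.2⟫_ℝ +
          κ * FunctionSpaces.Torus.laplacian (ψ p.1) p.2)) μ := fun n =>
      (hsol n).integrable_weakIntegrand hψ
    have hsplit : ∀ n (p : ℝ × UnitAddTorus d), θ n p.1 p.2 *
        (FunctionSpaces.Torus.timeDeriv ψ p.1 p.2 + ⟪v n p.1 p.2, FunctionSpaces.Torus.gradient (ψ p.1) p.2⟫_ℝ +
          κ * FunctionSpaces.Torus.laplacian (ψ p.1) p.2) =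
        θ n p.1 p.2 * G p.1 p.2 + θ n p.1 p.2 * H n p.1 p.2 := by
      intro n p
      simp only [hG, hH, inner_sub_left]
      ring
    have hθH : ∀ n, Integrable (fun p : ℝ × UnitAddTorus d => θ n p.1 p.2 * H n p.1 p.2) μ := by
      intro n
      have h := (hθGn n).sub (hθG n)
      refine h.congr (Eventually.of_forall fun p => ?_)
      simp only [Pi.sub_apply, hsplit n p, add_sub_cancel_left]
    have hident : ∀ n, (∫ t in Ioo 0 T, ∫ x, θ n t x * G t x) =
        -(∫ p, θ n p.1 p.2 * H n p.1 p.2 ∂μ) - ∫ x, g n x * ψ 0 x := by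
      intro n
      have h0 := (hsol n).integral_prod_weak_eq hψ
      have h1 : (∫ p, θ n p.1 p.2 *
          (FunctionSpaces.Torus.timeDeriv ψ p.1 p.2 + ⟪v n p.1 p.2, FunctionSpaces.Torus.gradient (ψ p.1) p.2⟫_ℝ +
            κ * FunctionSpaces.Torus.laplacian (ψ p.1) p.2) ∂μ) =
          (∫ p, θ n p.1 p.2 * G p.1 p.2 ∂μ) + ∫ p, θ n p.1 p.2 * H n p.1 p.2 ∂μ := by
        rw [← integral_add (hθG n) (hθH n)]
        exact integral_congr_ae (Eventually.of_forall fun p => hsplit n p)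
      have h2 : (∫ p, θ n p.1 p.2 * G p.1 p.2 ∂μ) = ∫ t in Ioo 0 T, ∫ x, θ n t x * G t x :=
        integral_prod _ (hθG n)
      rw [h1, h2] at h0
      linarith
    -- (c) the transport error `∫∫ θₙ ⟪vₙ - u, ∇ψ⟫ → 0`
    set B : ℝ≥0∞ := (C : ℝ≥0∞) * volume (Ioo (0 : ℝ) T) with hB
    have hBfin : B < ⊤ := ENNReal.mul_lt_top ENNReal.coe_lt_top measure_Ioo_lt_top
    have hθ2 : ∀ n, eLpNorm (uncurry (θ n)) 2 μ ≤ B ^ (1 / 2 : ℝ) := by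
      intro n
      have hfin : ∫⁻ t in Ioo 0 T, ∫⁻ x, ‖θ n t x‖ₑ ^ 2 ≤ B :=
        calc ∫⁻ t in Ioo 0 T, ∫⁻ x, ‖θ n t x‖ₑ ^ 2 ≤ ∫⁻ _ in Ioo (0 : ℝ) T, (C : ℝ≥0∞) :=
              lintegral_mono_ae (hbd n)
          _ = B := by rw [lintegral_const, Measure.restrict_apply_univ]
      have h := (FunctionSpaces.Torus.memLp_two_uncurry (hsol n).aestronglyMeasurable_uncurry (hfin.trans_lt hBfin)).2
      rw [FunctionSpaces.eLpNorm_two_eq_pow_two_rpow_half, h]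
      exact ENNReal.rpow_le_rpow hfin (by norm_num)
    set K : ℝ := |C₂| with hK
    have hvum : ∀ n, AEStronglyMeasurable (fun q : ℝ × UnitAddTorus d => v n q.1 q.2 - u q.1 q.2) μ := fun n =>
      (hsol n).aestronglyMeasurable_uncurry_velocity.sub hum
    have hJbound : ∀ n, eLpNorm (fun q : ℝ × UnitAddTorus d => v n q.1 q.2 - u q.1 q.2) 2 μ < ⊤ →
        ‖∫ p, θ n p.1 p.2 * H n p.1 p.2 ∂μ‖ ≤
        (ENNReal.ofReal K * (B ^ (1 / 2 : ℝ) *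
          eLpNorm (fun q : ℝ × UnitAddTorus d => v n q.1 q.2 - u q.1 q.2) 2 μ)).toReal := by
      intro n hfin
      have h1 : ‖∫ p, θ n p.1 p.2 * H n p.1 p.2 ∂μ‖ ≤
          (∫⁻ p, ‖θ n p.1 p.2 * H n p.1 p.2‖ₑ ∂μ).toReal := by
        rw [← integral_norm_eq_lintegral_enorm (hθH n).1]
        exact norm_integral_le_integral_norm _
      refine h1.trans (ENNReal.toReal_mono (ENNReal.mul_ne_top ENNReal.ofReal_ne_top
        (ENNReal.mul_ne_top (ENNReal.rpow_ne_top_of_nonneg (by norm_num) hBfin.ne) hfin.ne)) ?_)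
      have h2 : ∫⁻ p, ‖θ n p.1 p.2 * H n p.1 p.2‖ₑ ∂μ ≤
          ∫⁻ p, ENNReal.ofReal K * (‖θ n p.1 p.2‖ₑ * ‖v n p.1 p.2 - u p.1 p.2‖ₑ) ∂μ := by
        refine lintegral_mono_ae ?_
        filter_upwards [hae] with p hp
        have hp' : p.1 ∈ Icc 0 T := Ioo_subset_Icc_self hp
        have hin : ‖H n p.1 p.2‖ₑ ≤ ‖v n p.1 p.2 - u p.1 p.2‖ₑ * ENNReal.ofReal K := by
          rw [hH, ← ofReal_norm, ← ofReal_norm, ← ENNReal.ofReal_mul (norm_nonneg _)]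
          refine ENNReal.ofReal_le_ofReal ?_
          exact (norm_inner_le_norm _ _).trans (mul_le_mul_of_nonneg_left
            ((hC₂ p.1 hp' p.2).trans (le_abs_self _)) (norm_nonneg _))
        rw [enorm_mul]
        calc ‖θ n p.1 p.2‖ₑ * ‖H n p.1 p.2‖ₑ
            ≤ ‖θ n p.1 p.2‖ₑ * (‖v n p.1 p.2 - u p.1 p.2‖ₑ * ENNReal.ofReal K) := by gcongr
          _ = ENNReal.ofReal K * (‖θ n p.1 p.2‖ₑ * ‖v n p.1 p.2 - u p.1 p.2‖ₑ) := by ring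
      refine h2.trans ?_
      rw [lintegral_const_mul' _ _ ENNReal.ofReal_ne_top]
      gcongr
      have h3 := ENNReal.lintegral_mul_le_Lp_mul_Lq μ Real.HolderConjugate.two_two
        (hsol n).aestronglyMeasurable_uncurry.enorm (hvum n).enorm
      calc ∫⁻ p, ‖θ n p.1 p.2‖ₑ * ‖v n p.1 p.2 - u p.1 p.2‖ₑ ∂μ
          ≤ (∫⁻ p, ‖uncurry (θ n) p‖ₑ ^ (2 : ℝ) ∂μ) ^ (1 / (2 : ℝ)) *
            (∫⁻ p : ℝ × UnitAddTorus d, ‖v n p.1 p.2 - u p.1 p.2‖ₑ ^ (2 : ℝ) ∂μ) ^ (1 / (2 : ℝ)) := h3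
        _ = eLpNorm (uncurry (θ n)) 2 μ * eLpNorm (fun q : ℝ × UnitAddTorus d => v n q.1 q.2 - u q.1 q.2) 2 μ := by
            rw [FunctionSpaces.lintegral_rpow_two_eq_eLpNorm, FunctionSpaces.lintegral_rpow_two_eq_eLpNorm]
        _ ≤ B ^ (1 / 2 : ℝ) * eLpNorm (fun q : ℝ × UnitAddTorus d => v n q.1 q.2 - u q.1 q.2) 2 μ := by
            gcongr
            exact hθ2 n
    have hJ : Tendsto (fun n => ∫ p, θ n p.1 p.2 * H n p.1 p.2 ∂μ) atTop (𝓝 0) := by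
      have hlim0 : Tendsto (fun n => (ENNReal.ofReal K * (B ^ (1 / 2 : ℝ) *
          eLpNorm (fun q : ℝ × UnitAddTorus d => v n q.1 q.2 - u q.1 q.2) 2 μ)).toReal) atTop (𝓝 0) := by
        have h1 := ENNReal.Tendsto.const_mul hv (Or.inr (ENNReal.rpow_ne_top_of_nonneg (by norm_num) hBfin.ne))
          (a := B ^ (1 / 2 : ℝ))
        rw [mul_zero] at h1
        have h2 := ENNReal.Tendsto.const_mul h1 (Or.inr ENNReal.ofReal_ne_top) (a := ENNReal.ofReal K)
        rw [mul_zero] at h2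
        have h3 := (ENNReal.tendsto_toReal ENNReal.zero_ne_top).comp h2
        rwa [ENNReal.toReal_zero] at h3
      have hev : ∀ᶠ n in atTop, eLpNorm (fun q : ℝ × UnitAddTorus d => v n q.1 q.2 - u q.1 q.2) 2 μ < ⊤ :=
        (tendsto_order.1 hv).2 ⊤ ENNReal.zero_lt_top
      exact squeeze_zero_norm' (hev.mono fun n hn => hJbound n hn) hlim0
    -- (d) the datum term `∫ gₙ ψ(0) → ∫ θ₀ ψ(0)`
    have hD : Tendsto (fun n => ∫ x, g n x * ψ 0 x) atTop (𝓝 (∫ x, θ₀ x * ψ 0 x)) := by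
      have hψ0m : AEStronglyMeasurable (ψ 0) volume := hψ0c.aestronglyMeasurable
      have hI0 : Integrable (fun x => θ₀ x * ψ 0 x) volume :=
        (hθ₀.integrable one_le_two).mul_bdd hψ0m (Eventually.of_forall hψ0)
      have hIn : ∀ n, Integrable (fun x => g n x * ψ 0 x) volume := fun n =>
        ((hg n).integrable one_le_two).mul_bdd hψ0m (Eventually.of_forall hψ0)
      have hbound : ∀ n, ‖(∫ x, g n x * ψ 0 x) - ∫ x, θ₀ x * ψ 0 x‖ ≤
          (ENNReal.ofReal C₀ * eLpNorm (g n - θ₀) 2 volume).toReal := by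
        intro n
        rw [← integral_sub (hIn n) hI0]
        have hm : AEStronglyMeasurable (fun x => g n x * ψ 0 x - θ₀ x * ψ 0 x) volume := ((hIn n).sub hI0).1
        have h1 : ‖∫ x, (g n x * ψ 0 x - θ₀ x * ψ 0 x)‖ ≤
            (∫⁻ x, ‖g n x * ψ 0 x - θ₀ x * ψ 0 x‖ₑ).toReal := by
          rw [← integral_norm_eq_lintegral_enorm hm]
          exact norm_integral_le_integral_norm _
        refine h1.trans (ENNReal.toReal_mono
          (ENNReal.mul_ne_top ENNReal.ofReal_ne_top ((hg n).sub hθ₀).eLpNorm_ne_top) ?_)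
        calc ∫⁻ x, ‖g n x * ψ 0 x - θ₀ x * ψ 0 x‖ₑ ≤ ∫⁻ x, ENNReal.ofReal C₀ * ‖(g n - θ₀) x‖ₑ := by
              refine lintegral_mono fun x => ?_
              rw [← sub_mul, enorm_mul, mul_comm, Pi.sub_apply]
              gcongr
              rw [← ofReal_norm]
              exact ENNReal.ofReal_le_ofReal (hψ0 x)
          _ = ENNReal.ofReal C₀ * eLpNorm (g n - θ₀) 1 volume := by
              rw [lintegral_const_mul' _ _ ENNReal.ofReal_ne_top, eLpNorm_one_eq_lintegral_enorm]
          _ ≤ ENNReal.ofReal C₀ * eLpNorm (g n - θ₀) 2 volume := by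
              gcongr
              exact eLpNorm_le_eLpNorm_of_exponent_le one_le_two ((hg n).sub hθ₀).1
      have hlim0 : Tendsto (fun n => (ENNReal.ofReal C₀ * eLpNorm (g n - θ₀) 2 volume).toReal) atTop (𝓝 0) := by
        have h := ENNReal.Tendsto.const_mul hgθ₀ (Or.inr ENNReal.ofReal_ne_top) (a := ENNReal.ofReal C₀)
        rw [mul_zero] at h
        have h' := (ENNReal.tendsto_toReal ENNReal.zero_ne_top).comp h
        rwa [ENNReal.toReal_zero] at h'
      rw [tendsto_iff_norm_sub_tendsto_zero]
      exact squeeze_zero (fun n => norm_nonneg _) hbound hlim0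
    -- (e) conclusion: `∫∫ W G = lim ∫∫ θₙ G = -lim (Jₙ + Dₙ) = -∫ θ₀ ψ(0)`
    have hA' : Tendsto (fun n => ∫ t in Ioo 0 T, ∫ x, θ n t x * G t x) atTop
        (𝓝 (-(0 : ℝ) - ∫ x, θ₀ x * ψ 0 x)) :=
      (hJ.neg.sub hD).congr fun n => (hident n).symm
    rw [tendsto_nhds_unique hA hA']
    ring

end Limit

/-! ## Existence for `T > 0` and the discharge -/

section Existence

variable [DecidableEq d]

/-- **Existence of weak solutions for bounded divergence-free drift, `T > 0`**
(DiPerna–Lions 1989, Prop. II.1, by the regularisation scheme of its proof in the parabolic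
setting: regularised drifts and data from `PassiveScalarExistenceApprox`, classical solutions
of the regularised problems by `Torus.exists_unique_isClassicalScalarTransportForcedOn_holds`,
the drift-independent a priori bound `‖θₙ(t)‖₂ ≤ ‖θ₀‖₂` from the classical energy identity,
weak-* compactness in `L^∞(0,T;L²)` and the identification `IsWeakScalarTransportOn.of_tendsto`).
[cite: DiPernaLions1989, Prop. II.1] -/
theorem exists_isWeakScalarTransportOn_of_pos {T κ : ℝ} (hκ : 0 < κ) (hT : 0 < T)
    {u : ℝ → UnitAddTorus d → EuclideanSpace ℝ d} {θ₀ : UnitAddTorus d → ℝ} (hθ₀ : MemLp θ₀ 2 volume)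
    (hu : MemLp (FunctionSpaces.Torus.stLift u) ⊤ (volume.restrict (Ioo 0 T ×ˢ univ)))
    (hdiv : ∀ᵐ t ∂(volume.restrict (Ioo 0 T)), FunctionSpaces.Torus.IsWeaklyDivFree (u t)) :
    ∃ θ : ℝ → UnitAddTorus d → ℝ, IsWeakScalarTransportOn T κ u θ₀ θ := by
  -- regularised data
  obtain ⟨v, hvs, hvdiv, hvlim⟩ := exists_smooth_isDivFree_tendsto_eLpNorm_sub hu hdiv
  obtain ⟨g, hgs, hgle, hglim⟩ := exists_isSmooth_tendsto_eLpNorm_sub hθ₀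
  -- classical solutions of the regularised problems
  have hcl : ∀ n, ∃ θ : ℝ → UnitAddTorus d → ℝ,
      IsClassicalScalarTransportOn (Icc 0 T) κ (v n) θ ∧ θ 0 = g n := by
    intro n
    obtain ⟨θ, hθ, h0, -⟩ := exists_unique_isClassicalScalarTransportOn_of_forced
      exists_unique_isClassicalScalarTransportForcedOn_holds hκ hT
      (FunctionSpaces.Torus.isSmoothSpaceTimeOn_of_contDiff (hvs n) _) (fun t _ => hvdiv n t) (hgs n)
    exact ⟨θ, hθ, h0⟩
  choose θ hθ hθ0 using hcl
  -- they are weak solutions with data `gₙ`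
  have hsol : ∀ n, IsWeakScalarTransportOn T κ (v n) (g n) (θ n) := by
    intro n
    have h := IsClassicalScalarTransportOn.isWeakScalarTransportOn_holds (hθ n) subset_rfl
    rwa [hθ0 n] at h
  -- the a priori bound `∫ |θₙ(t)|² ≤ ‖θ₀‖₂²` for `t ∈ [0, T]`
  set C : ℝ≥0 := (eLpNorm θ₀ 2 volume ^ 2).toNNReal with hC
  have hCeq : (C : ℝ≥0∞) = eLpNorm θ₀ 2 volume ^ 2 :=
    ENNReal.coe_toNNReal (ENNReal.pow_ne_top hθ₀.eLpNorm_ne_top)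
  have hbd' : ∀ n, ∀ t ∈ Icc 0 T, ∫⁻ x, ‖θ n t x‖ₑ ^ 2 ≤ C := by
    intro n t ht
    have hθc : Continuous (θ n t) := ((hθ n).smooth_scalar.isSmooth_slice ht).continuous
    have hgc : Continuous (g n) := (hgs n).continuous
    have hE := IsClassicalScalarTransportOn.scalarL2Sq_add_scalarDissipation_holds (hθ n) ht.1
      (Icc_subset_Icc_right ht.2)
    have hD := scalarDissipation_nonneg hκ.le (θ n) ht.1
    have hle : scalarL2Sq (θ n t) ≤ scalarL2Sq (g n) := by rw [← hθ0 n]; linarith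
    calc ∫⁻ x, ‖θ n t x‖ₑ ^ 2 = ENNReal.ofReal (scalarL2Sq (θ n t)) := lintegral_enorm_sq_eq_ofReal_integral_sq hθc
      _ ≤ ENNReal.ofReal (scalarL2Sq (g n)) := ENNReal.ofReal_le_ofReal hle
      _ = eLpNorm (g n) 2 volume ^ 2 := by
          rw [scalarL2Sq, ← lintegral_enorm_sq_eq_ofReal_integral_sq hgc, FunctionSpaces.eLpNorm_two_pow_two_eq_lintegral]
      _ ≤ eLpNorm θ₀ 2 volume ^ 2 := by gcongr; exact hgle n
      _ = C := hCeq.symm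
  have hbd : ∀ n, ∀ᵐ t ∂(volume.restrict (Ioo 0 T)), ∫⁻ x, ‖θ n t x‖ₑ ^ 2 ≤ C := fun n =>
    (ae_restrict_mem measurableSet_Ioo).mono fun t ht => hbd' n t (Ioo_subset_Icc_self ht)
  -- weak-* compactness and identification of the limit
  obtain ⟨φ, hφ, W, hWm, hWb, hWlim⟩ :=
    FunctionSpaces.Torus.exists_strictMono_weakLimit_of_lintegral_sq_le (fun n => (hsol n).aestronglyMeasurable) hbd
  exact ⟨W, IsWeakScalarTransportOn.of_tendsto (fun j => hsol (φ j)) (fun j => hbd (φ j)) hWm hWb hWlim hu hdiv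
    (hvlim.comp hφ.tendsto_atTop) hθ₀ (fun j => (hgs (φ j)).memLp 2) (hglim.comp hφ.tendsto_atTop)⟩

end Existence

/-- **Discharge of `Torus.exists_isWeakScalarTransportOn`** (existence of energy solutions of
the passive scalar equation on `T^d × [0,T)` for `κ > 0`, `θ₀ ∈ L²`, bounded weakly
divergence-free drift; DiPerna–Lions 1989, Prop. II.1 for the existence scheme, Evans 2010,
§7.1.2, Thm. 2–3 and DEIJ 2022, (1.2)–(1.3) for the energy inequality): for `T ≤ 0` the zero
field is a (degenerate) solution, for `T > 0` `exists_isWeakScalarTransportOn_of_pos` gives a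
weak solution, and the energy inequality `2κ ∫₀ᵀ ‖∇θ‖² ≤ ‖θ₀‖²_{L²}` holds for *every* weak
solution with bounded drift (`IsWeakScalarTransportOn.energy_ineq_holds`). [cite: DiPernaLions1989, Prop. II.1] -/
theorem exists_isWeakScalarTransportOn_holds : exists_isWeakScalarTransportOn (d := d) := by
  intro T κ hκ u θ₀ hθ₀ hu hdiv
  suffices h : ∃ θ : ℝ → UnitAddTorus d → ℝ, IsWeakScalarTransportOn T κ u θ₀ θ by
    obtain ⟨θ, hθ⟩ := h
    exact ⟨θ, hθ, IsWeakScalarTransportOn.energy_ineq_holds hκ hθ hθ₀ hu⟩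
  rcases le_or_gt T 0 with hT | hT
  · exact ⟨0, IsWeakScalarTransportOn.of_nonpos hT 0 hu.1⟩
  · classical
    exact exists_isWeakScalarTransportOn_of_pos hκ hT hθ₀ hu hdiv

end Torus

end Literature.Analysis.FluidPDE

end
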